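import Literature.NumberTheory.GaloisRepresentations.ContinuousShapiroOpenCoinducedMackeyDegree
import Literature.NumberTheory.GaloisRepresentations.ContinuousShapiroLiftMackeyH1
import Literature.NumberTheory.GaloisRepresentations.ContinuousShapiroOpenCoinducedConjugation
import HarnessLib

/-!
# The SEMI-LOCAL VANISHING CRITERION for restricted classes of an induced module:
# "`Hⁿ(K_v, Ind_L^K M) = ⊕_{w ∣ v} Hⁿ(L_w, M)`" read through the Shapiro isomorphisms (NSW (1.6.4)–(1.6.5); Serre VII §5)

Topic `NumberTheory/GaloisRepresentations` (continuous cochain cohomology); namespace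
`Literature.NumberTheory.GaloisRepresentations`.  Definitions with bodies (the evaluation-at-`1` morphism of
the permutation model in every universe, the Shapiro isomorphism read on `coindFin`) and theorems; NO named
fact, no `sorry`, no instance, no notation.  Sequel of `ContinuousShapiroOpenCoinducedMackeyDegree` (Mackey on
`Hⁿ` in every degree: `eq_zero_iff_forall_cohomologyMap_resCoindFinHomR_eq_zero`; bookkeeping
`cohomologyMap_map_id_eq_map`, `map_cohomologyMap_eq_map`, `continuousCohomology_map_congr`),
`ContinuousShapiroLiftMackeyH1` (`exists_orbitReps_bijective`), `ContinuousShapiroOpenCoinduced`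
(`coindOpen`, `coindOpenEquiv`, `shapiroOpenAddEquiv`), `ShapiroIsomorphism` (`shapiroAddEquiv = Hⁿ(S ↪ G,
coindEvalOne)`), `ContinuousCohomologyAdditiveTransport` (`continuousCohomologyAddEquiv_map`) and
`ContinuousShapiroOpenCoinducedConjugation` (`sh ∘ Hⁿ(R_{gW}) = conj_g ∘ sh`, `n = 1, 2`).

Setting.  `G`, `D` profinite, `θ : D →ₜ* G` continuous, `N ⊴ G` open normal, `N_D := θ⁻¹N`, `ρ : ContinuousRep
G ℤ M` on a DISCRETE `M`, `Maps(G ⧸ N, M) = coindFin ρ.toTopRep N` (`= (ρ.coindOpen N hN).toTopRep`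
definitionally), `sh_N^G : Hⁿ(G, Maps(G⧸N, M)) ≃+ Hⁿ(N, M)` and `sh_{N_D}^D` the Shapiro isomorphisms,
`Φ_c = resCoindFinHomR` the Mackey projections, `R_c = rTransHom` the right translations, `θ_N^*` the
restriction `Hⁿ(N, M) → Hⁿ(θ⁻¹N, M)` along `θ_N : θ⁻¹N → N` (`comapSubtypeHom`, `comapCoeffHom`), `σ · ` the
conjugation action `conjMap` of `σ ∈ G` on `Hⁿ(N, M)`.  Sources: Neukirch–Schmidt–Wingberg (1.5.6)–(1.5.7)
(double cosets), Prop. (1.6.4) (Shapiro) and (1.6.5) / Serre *Corps locaux* VII §5 (the `G/H`-module structure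
of `Hq(H, A)` "provient, par l'isomorphisme de Shapiro, de la structure de `G/H`-module de `M_G^H(A)`");
Brown III (5.6)(b).

## What is formalised

* §3 `coindFinEvalAtOne X U : Maps(G ⧸ U, X)|_U ⟶ X|_U` (`φ ↦ φ(1·U)`; the `Type`-universe version for a
  normal `U` is the tree's `ContinuousRep.coindOpenEvalOne`), `continuousCohomologyAddEquiv_refl'` (the
  scalar-free transport along the identity is the identity, universe-general), and
  **`shapiroOpenAddEquiv_eq_map_coindFinEvalAtOne`**: the tree's Shapiro isomorphism of the permutation model
  IS `Hⁿ(U ↪ G, ev₁)`.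
* §4 `ρ.shapiroCoindFinAddEquiv N hN n : Hⁿ(G, coindFin ρ N) ≃+ Hⁿ(N, M)` (the same map, typed on
  `coindFin`/`subgroupRep` so that it composes with `Φ_c`, `R_c`, `conjMap` without transport), `…_apply`,
  `…_rTransHom_one/_two`; the ONE-ORBIT IDENTITY **`shapiroCoindFinAddEquiv_cohomologyMap_resCoindFinHom_map`**
  (`sh_{N_D}^D (Hⁿ(Φ₁) (θ^* y)) = θ_N^* (sh_N^G y)`, every degree; both sides are `Hⁿ` of the pair
  `(θ⁻¹N → G, F ↦ F(1·N))`) and its twist `…_resCoindFinHomR_map` (`Φ_{σN}` against `Hⁿ(R_{σN})`); the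
  **SEMI-LOCAL VANISHING CRITERIA** **`map_restrict_eq_zero_iff_forall_orbitReps`** (every degree:
  `θ^* y = 0 ↔ ∀ i, θ_N^* (sh (Hⁿ(R_{g_i N}) y)) = 0` for double-coset representatives `g_i`) and
  **`map_restrict_eq_zero_iff_forall_conjMap_one/_two`** (`θ^* y = 0 ↔ ∀ σ : G, θ_N^* (σ · sh y) = 0` on `H¹`,
  `H²`) — "a class of `Ind_L^K M` is locally trivial at `v` iff the corresponding class over `L` is locally
  trivial at EVERY place of `L` above `v`" (places above `v` ↔ double cosets `Γ_{K_v} \\ Γ_K / Γ_L` ↔ the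
  conjugates `σ`); `finiteIndex_of_isOpen'` (helper).

Written by the width seat `bsd-line-cf2c-w3` g9 of cell `bsd-print-cf2` as the generic half of idle-width item
(M7) «Ш-condition transport under restricted Shapiro» (planner ruling (N-PT), 2026-08-29); the number-field layer
(`shaRestricted` of `Maps(Γ_K ⧸ N, M)` versus the locally-trivial classes of the layer over `G_{L,S}`) is the
sequel `GaloisCohomology/ShaRestrictedShapiroLayer`.  HONEST FRAMING: homological algebra of profinite groups
only; no arithmetic statement and no case of BSD is proved here.

## References
* J. Neukirch, A. Schmidt, K. Wingberg, *Cohomology of Number Fields*, 2nd ed. (2008), I §5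
  (1.5.6)–(1.5.7), I §6 Prop. (1.6.4), (1.6.5). [NeukirchSchmidtWingberg2008]
* J.-P. Serre, *Corps locaux* / *Local Fields* (1979), VII §5. [SerreLocalFields1979]
* J.-P. Serre, *Cohomologie galoisienne* (1994) / *Galois Cohomology* (1997), I §2.2, §2.5 Prop. 10.
  [SerreGaloisCohomology1997]
* K. S. Brown, *Cohomology of Groups*, GTM 87 (1982), III §5 Prop. (5.6)(b). [Brown1982]

## Design notes
* Universes: §3 (`coindFinEvalAtOne`) as in the Mackey files (`R : Type u`, `G : Type v`); from
  `shapiroOpenAddEquiv_eq_map_coindFinEvalAtOne` on as in `ContinuousShapiroOpenCoinduced` (`G D M : Type u`,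
  `R = ℤ`, `coindFin.{0, u}` written explicitly to keep unification cheap).
* The conjugation form is given for `n = 1, 2` only, because the tree's dictionary
  `shapiroOpenAddEquiv_coindOpenHRep_one/_two` is; the right-translation form holds in every degree.
-/

noncomputable section

open CategoryTheory

open scoped Classical

universe u v

namespace Literature.NumberTheory.GaloisRepresentations

open _root_.TopRep

/-! ## §3 The Shapiro isomorphism of the permutation model is `Hⁿ(U ↪ G, ev₁)` -/

section ShapiroUnfold

variable {R : Type u} [CommRing R] [TopologicalSpace R]
variable {G : Type v} [Group G] [TopologicalSpace G]

/-- **`ev₁ : Maps(G ⧸ U, X)|_U ⟶ X|_U`, `φ ↦ φ(1·U)`** — a morphism of topological `U`-representations (for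
`u ∈ U`, `(u ⋆ φ)(U) = u • φ(u⁻¹ U) = u • φ(U)`); the coefficient map of the Shapiro map of the permutation
model in every degree (the degree-one cocycle version is the tree's `ContinuousShapiroLift.evalOne`, the
`Type`-universe version for a normal `U` is `ContinuousRep.coindOpenEvalOne`).
[cite: SerreGaloisCohomology1997, I §2.5 Prop. 10] [cite: NeukirchSchmidtWingberg2008, I §6 Prop. (1.6.4)] -/
def coindFinEvalAtOne (X : TopRep.{v} R G) (U : Subgroup G) :
    TopRep.res (subgroupIncl U : U →* G) (coindFin X U) ⟶ subgroupRep X U :=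
  TopRep.ofHom
    { toContinuousLinearMap :=
        { toFun := fun φ => φ ((1 : G) : G ⧸ U)
          map_add' := fun _ _ => rfl
          map_smul' := fun _ _ => rfl
          cont := _root_.continuous_apply _ }
      isIntertwining' := fun u => by
        ext φ
        change (coindFin X U).ρ (u : G) φ ((1 : G) : G ⧸ U) = X.ρ (u : G) (φ ((1 : G) : G ⧸ U))
        rw [coindFin_ρ_apply, inv_smul_mk_one_of_mem U u.2] }

/-- Formula: `ev₁ φ = φ(1·U)`. [cite: SerreGaloisCohomology1997, I §2.5 Prop. 10] -/
@[simp]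
theorem coindFinEvalAtOne_apply (X : TopRep.{v} R G) (U : Subgroup G) (φ : coindFin X U) :
    (coindFinEvalAtOne X U).hom φ = φ ((1 : G) : G ⧸ U) := rfl

end ShapiroUnfold

section ReflTransport

variable {G : Type u} [Group G] [TopologicalSpace G] [IsTopologicalGroup G]

/-- `resolutionEquiv (refl) m = id` (universe-general copy of the tree's `Type`-level lemma).
[cite: SerreGaloisCohomology1997, I §2.2] -/
private theorem resolutionEquiv_refl_apply' {X : TopRep.{u} ℤ G} :
    ∀ (m : ℕ) (f : (resolutionX X m : Type u)),
      resolutionEquiv (ContinuousAddEquiv.refl (X : Type u)) m f = f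
  | 0, _ => rfl
  | m + 1, f => ContinuousMap.ext fun x => by
      rw [resolutionEquiv_succ_apply]
      exact resolutionEquiv_refl_apply' m (f x)

/-- The scalar-free transport `continuousCohomologyAddEquiv` along the identity is the identity
(universe-general copy of `continuousCohomologyAddEquiv_refl`). [cite: SerreGaloisCohomology1997, I §2.2] -/
theorem continuousCohomologyAddEquiv_refl' {X : TopRep.{u} ℤ G} (n : ℕ) (x : continuousCohomology n X) :
    continuousCohomologyAddEquiv (X := X) (Y := X) (ContinuousAddEquiv.refl (X : Type u))
      (fun _ _ => rfl) n x = x := by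
  obtain ⟨c, hc, rfl⟩ := cxClass_surjective (homogeneousCochains X) n (n + 1)
    (up_nat_next n) x
  rw [continuousCohomologyAddEquiv_cxClass]
  exact cxClass_congr (Subtype.ext (resolutionEquiv_refl_apply' (n + 1) c.1))

end ReflTransport

section ShapiroUnfoldRep

variable {G : Type u} [Group G] [TopologicalSpace G] [IsTopologicalGroup G] [CompactSpace G]
  [T2Space G] [TotallyDisconnectedSpace G]
variable {M : Type u} [AddCommGroup M] [TopologicalSpace M] [DiscreteTopology M]
variable (ρ : ContinuousRep G ℤ M) (U : Subgroup G) (hU : IsOpen (U : Set G))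

/-- **The Shapiro isomorphism of the permutation model IS `Hⁿ(U ↪ G, ev₁)`**: `ρ.shapiroOpenAddEquiv U hU n x
= Hⁿ(subgroupIncl U, coindFinEvalAtOne) x` (transport along `coindOpenEquiv` followed by Serre's
`Hⁿ(U ↪ G, a* ↦ a*(1))`, and `(coindOpenEquiv φ)(1) = 1 • φ(1⁻¹ U) = φ(U)`).
[cite: SerreGaloisCohomology1997, I §2.5 Prop. 10] [cite: NeukirchSchmidtWingberg2008, I §6 Prop. (1.6.4)] -/
theorem shapiroOpenAddEquiv_eq_map_coindFinEvalAtOne (n : ℕ)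
    (x : continuousCohomology n (ρ.coindOpen U hU).toTopRep) :
    ρ.shapiroOpenAddEquiv U hU n x =
      (ContinuousCohomology.map (subgroupIncl U) (X := coindFin.{0, u} ρ.toTopRep U)
        (coindFinEvalAtOne ρ.toTopRep U) n).hom x := by
  haveI : IsClosed (U : Set G) := Subgroup.isClosed_of_isOpen U hU
  unfold ContinuousRep.shapiroOpenAddEquiv
  rw [AddEquiv.trans_apply, shapiroAddEquiv_apply]
  have hnat := continuousCohomologyAddEquiv_map
    (X := (ρ.coindOpen U hU).toTopRep) (X' := (coindRep (ρ.restrict (subgroupIncl U))).toTopRep)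
    (Y := (ρ.restrict (subgroupIncl U)).toTopRep) (Y' := (ρ.restrict (subgroupIncl U)).toTopRep)
    (ρ.coindOpenEquiv U hU : (G ⧸ U → M) ≃ₜ+ _) (fun g φ => ρ.coindOpenEquiv_map U hU g φ)
    (ContinuousAddEquiv.refl M) (fun _ _ => rfl)
    (subgroupIncl U) (coindFinEvalAtOne ρ.toTopRep U) (coindEvalOne (ρ.restrict (subgroupIncl U)))
    (fun φ => by
      change φ ((1 : G) : G ⧸ U) = ((ρ.toCoindModule U hU φ : coindModule (ρ.restrict (subgroupIncl U))) :
        C(G, M)) 1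
      rw [ContinuousRep.toCoindModule_apply, inv_one, map_one, Module.End.one_apply]) n x
  rw [← hnat]
  exact continuousCohomologyAddEquiv_refl' n _

end ShapiroUnfoldRep

/-! ## §4 The SEMI-LOCAL VANISHING CRITERION for restricted classes of `Maps(G ⧸ N, M)` -/

section Vanishing

variable {G : Type u} [Group G] [TopologicalSpace G] [IsTopologicalGroup G] [CompactSpace G]
  [T2Space G] [TotallyDisconnectedSpace G]
variable {M : Type u} [AddCommGroup M] [TopologicalSpace M] [DiscreteTopology M]
variable (ρ : ContinuousRep G ℤ M) (N : Subgroup G) (hN : IsOpen (N : Set G))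

/-- **The Shapiro isomorphism `sh : Hⁿ(G, Maps(G ⧸ N, M)) ≃+ Hⁿ(N, M)` read on the tree's `coindFin ρ.toTopRep N` /
`subgroupRep ρ.toTopRep N`** (the SAME map as `ρ.shapiroOpenAddEquiv N hN n`, whose source
`(ρ.coindOpen N hN).toTopRep` is `coindFin ρ.toTopRep N` definitionally, `ContinuousRep.toTopRep_coindOpen`), so
that it composes with the `coindFin`-currency maps `Φ_c`, `R_c`, `conjMap` without transport.
[cite: SerreGaloisCohomology1997, I §2.5 Prop. 10] [cite: NeukirchSchmidtWingberg2008, I §6 Prop. (1.6.4)] -/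
def ContinuousRep.shapiroCoindFinAddEquiv (n : ℕ) :
    (continuousCohomology n (coindFin.{0, u} ρ.toTopRep N) : Type u) ≃+
      (continuousCohomology n (subgroupRep ρ.toTopRep N) : Type u) :=
  ρ.shapiroOpenAddEquiv N hN n

/-- `shapiroCoindFinAddEquiv = Hⁿ(N ↪ G, ev₁)`. [cite: SerreGaloisCohomology1997, I §2.5 Prop. 10] -/
theorem ContinuousRep.shapiroCoindFinAddEquiv_apply (n : ℕ) (y : continuousCohomology n (coindFin.{0, u} ρ.toTopRep N)) :
    ρ.shapiroCoindFinAddEquiv N hN n y =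
      (ContinuousCohomology.map (subgroupIncl N) (coindFinEvalAtOne ρ.toTopRep N) n).hom y :=
  shapiroOpenAddEquiv_eq_map_coindFinEvalAtOne ρ N hN n y

/-- **`sh (H¹(R_{σN}) y) = σ · sh y`** in the `coindFin` currency (the tree's
`shapiroOpenAddEquiv_coindOpenHRep_one`). [cite: SerreLocalFields1979, VII §5] [cite: NeukirchSchmidtWingberg2008, I §6 Prop. (1.6.5)] -/
theorem ContinuousRep.shapiroCoindFinAddEquiv_rTransHom_one [N.Normal] (σ : G)
    (y : continuousCohomology 1 (coindFin.{0, u} ρ.toTopRep N)) :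
    ρ.shapiroCoindFinAddEquiv N hN 1 (cohomologyMap (rTransHom ρ.toTopRep N (σ : G ⧸ N)) 1 y) =
      conjMap ρ.toTopRep N σ 1 (ρ.shapiroCoindFinAddEquiv N hN 1 y) :=
  ContinuousRep.shapiroOpenAddEquiv_coindOpenHRep_one ρ N hN σ y

/-- **`sh (H²(R_{σN}) y) = σ · sh y`** in the `coindFin` currency (the tree's
`shapiroOpenAddEquiv_coindOpenHRep_two`). [cite: SerreLocalFields1979, VII §5] [cite: NeukirchSchmidtWingberg2008, I §6 Prop. (1.6.5)] -/
theorem ContinuousRep.shapiroCoindFinAddEquiv_rTransHom_two [N.Normal] (σ : G)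
    (y : continuousCohomology 2 (coindFin.{0, u} ρ.toTopRep N)) :
    ρ.shapiroCoindFinAddEquiv N hN 2 (cohomologyMap (rTransHom ρ.toTopRep N (σ : G ⧸ N)) 2 y) =
      conjMap ρ.toTopRep N σ 2 (ρ.shapiroCoindFinAddEquiv N hN 2 y) :=
  ContinuousRep.shapiroOpenAddEquiv_coindOpenHRep_two ρ N hN σ y

variable {D : Type u} [Group D] [TopologicalSpace D] [IsTopologicalGroup D] [CompactSpace D]
  [T2Space D] [TotallyDisconnectedSpace D]
variable [N.Normal] (θ : D →ₜ* G)

omit [N.Normal] in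
/-- **The ONE-ORBIT IDENTITY, every degree**: for a global class `y ∈ Hⁿ(G, Maps(G ⧸ N, M))`,
`sh_{θ⁻¹N}^D (Hⁿ(Φ₁) (θ^* y)) = θ_N^* (sh_N^G y)` in `Hⁿ(θ⁻¹N, M)` — the Mackey coordinate of the trivial
double coset, read through the local Shapiro isomorphism, is the restriction along `θ_N : θ⁻¹N → N` of the
layer class (both sides are `Hⁿ` of the pair `(θ⁻¹N → G, F ↦ F(1·N))`).  The degree-one Shapiro-lift form is
the tree's `map_resCoindFinHom_shapiroLift`. [cite: NeukirchSchmidtWingberg2008, I §6 Prop. (1.6.4)]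
[cite: Brown1982, III §5 (5.6)(b)] -/
theorem shapiroCoindFinAddEquiv_cohomologyMap_resCoindFinHom_map (n : ℕ)
    (y : continuousCohomology n (coindFin.{0, u} ρ.toTopRep N)) :
    (ρ.restrict θ).shapiroCoindFinAddEquiv (N.comap (θ : D →* G)) (isOpen_comap N θ hN) n
        (cohomologyMap (resCoindFinHom ρ.toTopRep N θ) n
          ((ContinuousCohomology.map θ (𝟙 (TopRep.res (θ : D →* G) (coindFin.{0, u} ρ.toTopRep N))) n).hom y)) =
      (ContinuousCohomology.map (comapSubtypeHom N θ) (comapCoeffHom ρ.toTopRep N θ) n).hom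
        (ρ.shapiroCoindFinAddEquiv N hN n y) := by
  rw [ContinuousRep.shapiroCoindFinAddEquiv_apply, ContinuousRep.shapiroCoindFinAddEquiv_apply,
    cohomologyMap_map_id_eq_map]
  -- both sides are `Hⁿ` of a composite pair out of `(G, Maps(G ⧸ N, M))`
  have hL := ContinuousCohomology.map_comp θ (subgroupIncl (N.comap (θ : D →* G)))
    (X := coindFin.{0, u} ρ.toTopRep N) (Y := coindFin.{0, u} (TopRep.res (θ : D →* G) ρ.toTopRep) (N.comap (θ : D →* G)))
    (Z := subgroupRep (TopRep.res (θ : D →* G) ρ.toTopRep) (N.comap (θ : D →* G)))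
    (resCoindFinHom ρ.toTopRep N θ) (coindFinEvalAtOne (TopRep.res (θ : D →* G) ρ.toTopRep) (N.comap (θ : D →* G))) n
  have hR := ContinuousCohomology.map_comp (subgroupIncl N) (comapSubtypeHom N θ)
    (X := coindFin.{0, u} ρ.toTopRep N) (Y := subgroupRep ρ.toTopRep N)
    (Z := subgroupRep (TopRep.res (θ : D →* G) ρ.toTopRep) (N.comap (θ : D →* G)))
    (coindFinEvalAtOne ρ.toTopRep N) (comapCoeffHom ρ.toTopRep N θ) n
  have hθ : θ.comp (subgroupIncl (N.comap (θ : D →* G))) = (subgroupIncl N).comp (comapSubtypeHom N θ) :=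
    ContinuousMonoidHom.ext fun _ => rfl
  have key := continuousCohomology_map_congr hθ
    ((TopRep.resFunctor (subgroupIncl (N.comap (θ : D →* G)) : N.comap (θ : D →* G) →* D)).map
        (resCoindFinHom ρ.toTopRep N θ) ≫
      coindFinEvalAtOne (TopRep.res (θ : D →* G) ρ.toTopRep) (N.comap (θ : D →* G)))
    ((TopRep.resFunctor (comapSubtypeHom N θ : N.comap (θ : D →* G) →* N)).map (coindFinEvalAtOne ρ.toTopRep N) ≫
      comapCoeffHom ρ.toTopRep N θ)
    (fun F => by
      change ((resCoindFinHom ρ.toTopRep N θ).hom F) ((1 : D) : D ⧸ N.comap (θ : D →* G)) =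
        F ((1 : G) : G ⧸ N)
      rw [resCoindFinHom_apply, quotientMapOfHom_mk, map_one]) n
  exact ((congrArg (fun T => T.hom y) (key.symm.trans hL)).symm).trans (congrArg (fun T => T.hom y) hR)

/-- **The Mackey coordinate at the double coset of `σ`, every degree**:
`sh_{θ⁻¹N}^D (Hⁿ(Φ_{σN}) (θ^* y)) = θ_N^* (sh_N^G (Hⁿ(R_{σN}) y))` (`Φ_{σN} = Φ₁ ∘ R_{σN}` and the one-orbit
identity applied to `Hⁿ(R_{σN}) y`). [cite: Brown1982, III §5 (5.6)(b)] [cite: SerreLocalFields1979, VII §5] -/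
theorem shapiroCoindFinAddEquiv_cohomologyMap_resCoindFinHomR_map (n : ℕ) (σ : G)
    (y : continuousCohomology n (coindFin.{0, u} ρ.toTopRep N)) :
    (ρ.restrict θ).shapiroCoindFinAddEquiv (N.comap (θ : D →* G)) (isOpen_comap N θ hN) n
        (cohomologyMap (resCoindFinHomR ρ.toTopRep N θ (σ : G ⧸ N)) n
          ((ContinuousCohomology.map θ (𝟙 (TopRep.res (θ : D →* G) (coindFin.{0, u} ρ.toTopRep N))) n).hom y)) =
      (ContinuousCohomology.map (comapSubtypeHom N θ) (comapCoeffHom ρ.toTopRep N θ) n).hom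
        (ρ.shapiroCoindFinAddEquiv N hN n (cohomologyMap (rTransHom ρ.toTopRep N (σ : G ⧸ N)) n y)) := by
  rw [← shapiroCoindFinAddEquiv_cohomologyMap_resCoindFinHom_map, cohomologyMap_map_id_eq_map,
    cohomologyMap_map_id_eq_map, map_cohomologyMap_eq_map]
  exact congrArg (fun T => (ρ.restrict θ).shapiroCoindFinAddEquiv (N.comap (θ : D →* G)) (isOpen_comap N θ hN) n
    (TopModuleCat.Hom.hom T y)) (continuousCohomology_map_congr rfl (resCoindFinHomR ρ.toTopRep N θ (σ : G ⧸ N))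
      ((TopRep.resFunctor (θ : D →* G)).map (rTransHom ρ.toTopRep N (σ : G ⧸ N)) ≫ resCoindFinHom ρ.toTopRep N θ)
      (fun F => resCoindFinHomR_eq_rTransHom ρ.toTopRep N θ (σ : G ⧸ N) F) n)

/-- **SEMI-LOCAL VANISHING CRITERION, right-translation form, every degree**: for representatives `g_i` of the
double cosets `θ(D) \ G / N`, a global class `y ∈ Hⁿ(G, Maps(G ⧸ N, M))` restricts to zero along `θ` iff every
layer class `θ_N^* (sh (Hⁿ(R_{g_i N}) y)) ∈ Hⁿ(θ⁻¹N, M)` vanishes (Mackey on `Hⁿ` + the local Shapiro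
isomorphism per orbit).  Dictionary: `G = Γ_K`, `N = Γ_L`, `D = Γ_{K_v}`, `θ` the decomposition embedding,
`θ⁻¹N = Γ_{L_{w_i}}`: "`Hⁿ(K_v, Ind_L^K M) = ⊕_{w ∣ v} Hⁿ(L_w, M)`".
[cite: NeukirchSchmidtWingberg2008, I §5 (1.5.6)–(1.5.7), I §6 Prop. (1.6.4)] [cite: Brown1982, III §5 (5.6)(b)] -/
theorem map_restrict_eq_zero_iff_forall_orbitReps {ι : Type u} [Fintype ι] (g : ι → G)
    (hbij : Function.Bijective fun q : ι × (D ⧸ N.comap (θ : D →* G)) => quotientMapOfHom N θ q.2 * (g q.1 : G ⧸ N))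
    (n : ℕ) (y : continuousCohomology n (coindFin.{0, u} ρ.toTopRep N)) :
    (ContinuousCohomology.map θ (𝟙 (TopRep.res (θ : D →* G) (coindFin.{0, u} ρ.toTopRep N))) n).hom y = 0 ↔
      ∀ i, (ContinuousCohomology.map (comapSubtypeHom N θ) (comapCoeffHom ρ.toTopRep N θ) n).hom
        (ρ.shapiroCoindFinAddEquiv N hN n (cohomologyMap (rTransHom ρ.toTopRep N (g i : G ⧸ N)) n y)) = 0 := by
  refine (eq_zero_iff_forall_cohomologyMap_resCoindFinHomR_eq_zero ρ.toTopRep N θ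
    (fun i => (g i : G ⧸ N)) hbij n _).trans (forall_congr' fun i => ?_)
  rw [← shapiroCoindFinAddEquiv_cohomologyMap_resCoindFinHomR_map]
  exact (AddEquiv.map_eq_zero_iff _).symm

include hN in
omit [T2Space G] [TotallyDisconnectedSpace G] [N.Normal] in
/-- An open subgroup of a compact group has finite index (instance helper).
[cite: SerreGaloisCohomology1997, I §1.1 (open subgroups of profinite groups)] -/
theorem finiteIndex_of_isOpen' : N.FiniteIndex := by
  haveI : Finite (G ⧸ N) := Subgroup.quotient_finite_of_isOpen N hN
  exact Subgroup.finiteIndex_of_finite_quotient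

/-- **SEMI-LOCAL VANISHING CRITERION on `H¹`, conjugation form**: a global class `y ∈ H¹(G, Maps(G ⧸ N, M))`
restricts to zero along `θ : D → G` iff for EVERY `σ ∈ G` the layer class `θ_N^* (σ · sh y) ∈ H¹(θ⁻¹N, M)`
vanishes, `sh` the Shapiro isomorphism onto `H¹(N, M)` and `σ ·` the conjugation action `conjMap`.  (Number
fields: a class of `H¹(K, Ind_L^K M)` is locally trivial at `v` iff the corresponding class of `H¹(L, M)` is
locally trivial at every place of `L` above `v` — the places above `v` being the conjugates `σ`.)
[cite: NeukirchSchmidtWingberg2008, I §5 (1.5.6)–(1.5.7), I §6 (1.6.4)–(1.6.5)] [cite: SerreLocalFields1979, VII §5] -/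
theorem map_restrict_eq_zero_iff_forall_conjMap_one
    (y : continuousCohomology 1 (coindFin.{0, u} ρ.toTopRep N)) :
    (ContinuousCohomology.map θ (𝟙 (TopRep.res (θ : D →* G) (coindFin.{0, u} ρ.toTopRep N))) 1).hom y = 0 ↔
      ∀ σ : G, (ContinuousCohomology.map (comapSubtypeHom N θ) (comapCoeffHom ρ.toTopRep N θ) 1).hom
        (conjMap ρ.toTopRep N σ 1 (ρ.shapiroCoindFinAddEquiv N hN 1 y)) = 0 := by
  haveI : N.FiniteIndex := finiteIndex_of_isOpen' N hN
  obtain ⟨ι, _, g, hbij⟩ := exists_orbitReps_bijective N θ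
  rw [map_restrict_eq_zero_iff_forall_orbitReps ρ N hN θ g hbij 1 y]
  constructor
  · intro h σ
    rw [← ContinuousRep.shapiroCoindFinAddEquiv_rTransHom_one,
      ← shapiroCoindFinAddEquiv_cohomologyMap_resCoindFinHomR_map,
      (map_restrict_eq_zero_iff_forall_orbitReps ρ N hN θ g hbij 1 y).2 h, map_zero]
    exact map_zero _
  · intro h i
    rw [ContinuousRep.shapiroCoindFinAddEquiv_rTransHom_one]
    exact h (g i)

/-- **SEMI-LOCAL VANISHING CRITERION on `H²`, conjugation form** (as
`map_restrict_eq_zero_iff_forall_conjMap_one`, in degree `2`).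
[cite: NeukirchSchmidtWingberg2008, I §5 (1.5.6)–(1.5.7), I §6 (1.6.4)–(1.6.5)] [cite: SerreLocalFields1979, VII §5] -/
theorem map_restrict_eq_zero_iff_forall_conjMap_two
    (y : continuousCohomology 2 (coindFin.{0, u} ρ.toTopRep N)) :
    (ContinuousCohomology.map θ (𝟙 (TopRep.res (θ : D →* G) (coindFin.{0, u} ρ.toTopRep N))) 2).hom y = 0 ↔
      ∀ σ : G, (ContinuousCohomology.map (comapSubtypeHom N θ) (comapCoeffHom ρ.toTopRep N θ) 2).hom
        (conjMap ρ.toTopRep N σ 2 (ρ.shapiroCoindFinAddEquiv N hN 2 y)) = 0 := by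
  haveI : N.FiniteIndex := finiteIndex_of_isOpen' N hN
  obtain ⟨ι, _, g, hbij⟩ := exists_orbitReps_bijective N θ
  rw [map_restrict_eq_zero_iff_forall_orbitReps ρ N hN θ g hbij 2 y]
  constructor
  · intro h σ
    rw [← ContinuousRep.shapiroCoindFinAddEquiv_rTransHom_two,
      ← shapiroCoindFinAddEquiv_cohomologyMap_resCoindFinHomR_map,
      (map_restrict_eq_zero_iff_forall_orbitReps ρ N hN θ g hbij 2 y).2 h, map_zero]
    exact map_zero _
  · intro h i
    rw [ContinuousRep.shapiroCoindFinAddEquiv_rTransHom_two]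
    exact h (g i)

end Vanishing

end Literature.NumberTheory.GaloisRepresentations

end
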